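import Summits.RiemannHypothesis.RiemannHypothesis.Theorems.WeilFormatCDeflatedFarSectorEven
import HarnessLib

/-!
# Format C, design C∞: sector bookkeeping for ODD profiles — kernel rows in the odd sector

Route context: Fourier–Galerkin / Schur-complement certificates of Weil positivity on a window ("format C";
cell memo `run/shared/lean/pub/rh-explicit/rh-explicit-weil-10/KERNEL-LEVER.md` §18–§19; supporting
stmt-RiemannHypothesis-0098; seat rh-explicit-weil-10).

Companion of `WeilFormatCDeflatedFarSectorEven` for the ODD sector of Yoshida's matrix `G = gramCoeff a`:
`M⁻(k,l) = (G(k+1,l+1) − G(k+1,−(l+1)))/2` (sector index `k` = mode `k + 1`), profiles = odd windows.  An odd REAL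
window has odd, purely IMAGINARY Fourier coefficients, so the real profile table is built from `Im ĉ`:

* `fourierCoeff_neg_eq_neg_of_odd`, `re_fourierCoeff_eq_zero_of_odd_real`, `fourierCoeff_eq_im_mul_I` — `ĉ_{−n} = −ĉ_n`,
  `ĉ_n = (Im ĉ_n)·i`;
* `weilWindowSesq_chiOdd_chiOdd` — `W_a(w⁻_{k+1}, w⁻_{l+1}) = 2·M⁻(k,l)`;
* `band_eq_sum_chiOdd` — for an odd window, `proj_P φ − proj_B φ = Σ_{k∈[B,P)} ζ_{k+1} • w⁻_{k+1}`,
  `ζ_i = √2 ĉ_i/√(2a) = (√2 Im ĉ_i/√(2a))·i`;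
* `sum_Ico_oddKernel_mul_eq` — THE ROW IDENTITY: with the real table `V(k) = 2 Im ĉ_{k+1}(φ)/√(2a)`,
  `Σ_{k∈[B,P)} M⁻(k,m)V(k) = Im W_a(proj_P φ − proj_B φ, w⁻_{m+1})/√2`;
* `sum_Ico_Ico_oddKernel_eq` — `Σ_{k,l} V_φ(k)M⁻(k,l)V_ψ(l) = Re W_a(band φ, band ψ)`;
* `tendsto_sum_Ico_oddKernel_mul`, `tendsto_sum_Ico_Ico_oddKernel` — for admissible odd real profiles `1f`
  (`f ∈ C³`, odd, real, `f(a) = 0`, `f′(−a) = f′(a)`) the hypotheses `hc`, `hG` of `sum_range_mul_mul_nonneg_of_certificate_cinf`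
  with the limits `Im W_a(1f − proj_B(1f), w⁻_{m+1})/√2` and `Re W_a(1f − proj_B 1f, 1g − proj_B 1g)`.

Pure bookkeeping on landed identities; standard axioms; no definitions; no RH claim.
-/

set_option autoImplicit false
-- `Summit.RiemannHypothesis.RiemannHypothesis.…` is the layout-mandated namespace (summit = problem name).
set_option linter.dupNamespace false

noncomputable section

open Complex Filter Set MeasureTheory Finset
open scoped Real Topology ComplexConjugate

namespace Summit.RiemannHypothesis.RiemannHypothesis.Theorems.WeilFormatC

open Literature.NumberTheory.LFunctions Literature.NumberTheory.LFunctions.Yoshida1992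

variable {a : ℝ}

/-! ## Fourier coefficients of odd real windows -/

/-- Odd windows have odd coefficients: `ĉ_{−n}(φ) = −ĉ_n(φ)`. -/
theorem fourierCoeff_neg_eq_neg_of_odd {φ : ℝ → ℂ} (hφ : ∀ x, φ (-x) = -φ x) (a : ℝ) (n : ℤ) :
    Yoshida1992.fourierCoeff a (-n) φ = -Yoshida1992.fourierCoeff a n φ := by
  rw [← fourierCoeff_comp_neg, ← fourierCoeff_neg]
  congr 1
  funext x
  rw [hφ, Pi.neg_apply]

/-- Odd REAL windows have purely imaginary coefficients: `Re ĉ_n(φ) = 0`. -/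
theorem re_fourierCoeff_eq_zero_of_odd_real {φ : ℝ → ℂ} (hφ : ∀ x, φ (-x) = -φ x) (hφr : ∀ x, conj (φ x) = φ x)
    (a : ℝ) (n : ℤ) :
    (Yoshida1992.fourierCoeff a n φ).re = 0 := by
  have h := conj_fourierCoeff a n φ
  simp_rw [hφr] at h
  rw [fourierCoeff_neg_eq_neg_of_odd hφ] at h
  have hre := congrArg Complex.re h
  rw [Complex.conj_re, Complex.neg_re] at hre
  linarith

/-- A purely imaginary coefficient as `(Im ĉ_n)·i`. -/
theorem fourierCoeff_eq_im_mul_I {φ : ℝ → ℂ} (hφ : ∀ x, φ (-x) = -φ x) (hφr : ∀ x, conj (φ x) = φ x)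
    (a : ℝ) (n : ℤ) :
    Yoshida1992.fourierCoeff a n φ = (((Yoshida1992.fourierCoeff a n φ).im : ℝ) : ℂ) * I := by
  apply Complex.ext
  · simp [re_fourierCoeff_eq_zero_of_odd_real hφ hφr]
  · simp

/-- The indicator of an odd function on `[−a, a]` is odd. -/
theorem indicator_odd {f : ℝ → ℂ} (hf : ∀ x, f (-x) = -f x) (a x : ℝ) :
    (Icc (-a) a).indicator f (-x) = -(Icc (-a) a).indicator f x := by
  by_cases hx : x ∈ Icc (-a) a
  · have hx' : -x ∈ Icc (-a) a := ⟨by linarith [hx.2], by linarith [hx.1]⟩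
    rw [indicator_of_mem hx, indicator_of_mem hx', hf]
  · have hx' : -x ∉ Icc (-a) a := fun h ↦ hx ⟨by linarith [h.2], by linarith [h.1]⟩
    rw [indicator_of_notMem hx, indicator_of_notMem hx', neg_zero]

/-! ## The odd basis Gram is twice the odd kernel -/

/-- **`W_a(w⁻_{k+1}, w⁻_{l+1}) = 2 M⁻(k,l)`**, `M⁻` the odd sector kernel of `G = gramCoeff a` (`a > 0`). -/
theorem weilWindowSesq_chiOdd_chiOdd (ha : 0 < a) (k l : ℕ) :
    weilWindowSesq a (chiOdd a (k + 1)) (chiOdd a (l + 1)) =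
      ((2 * ((gramCoeff a ((k : ℤ) + 1) ((l : ℤ) + 1) - gramCoeff a ((k : ℤ) + 1) (-((l : ℤ) + 1))) / 2) : ℝ) : ℂ) := by
  have hs2 : Real.sqrt 2 * Real.sqrt 2 = 2 := Real.mul_self_sqrt (by norm_num)
  have hsC : ((1 / Real.sqrt 2 : ℝ) : ℂ) = ((Real.sqrt 2 : ℝ) : ℂ) / 2 := by
    rw [← Complex.ofReal_ofNat, ← Complex.ofReal_div]
    congr 1
    rw [div_eq_div_iff (Real.sqrt_pos.2 (by norm_num : (0:ℝ) < 2)).ne' two_ne_zero, one_mul, hs2]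
  have hs2C : ((Real.sqrt 2 : ℝ) : ℂ) * ((Real.sqrt 2 : ℝ) : ℂ) = 2 := by
    rw [← Complex.ofReal_mul, hs2]; norm_num
  unfold chiOdd
  rw [weilWindowSesq_smul_left, weilWindowSesq_smul_right, Complex.conj_ofReal,
    weilWindowSesq_sub_left ha.le (isWindowFunction_chi ha _) (isWindowFunction_chi ha _)
      ((isWindowFunction_chi ha _).sub (isWindowFunction_chi ha _)),
    weilWindowSesq_sub_right ha.le (isWindowFunction_chi ha _) (isWindowFunction_chi ha _)
      (isWindowFunction_chi ha _),
    weilWindowSesq_sub_right ha.le (isWindowFunction_chi ha _) (isWindowFunction_chi ha _)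
      (isWindowFunction_chi ha _),
    weilWindowSesq_chi ha, weilWindowSesq_chi ha, weilWindowSesq_chi ha, weilWindowSesq_chi ha]
  have e1 : gramCoeff a (-(((k + 1 : ℕ) : ℤ))) (-(((l + 1 : ℕ) : ℤ))) = gramCoeff a ((k + 1 : ℕ) : ℤ) ((l + 1 : ℕ) : ℤ) :=
    gramCoeff_neg_neg a _ _
  have e2 : gramCoeff a (-(((k + 1 : ℕ) : ℤ))) ((l + 1 : ℕ) : ℤ) = gramCoeff a ((k + 1 : ℕ) : ℤ) (-(((l + 1 : ℕ) : ℤ))) := by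
    rw [← gramCoeff_neg_neg a (-(((k + 1 : ℕ) : ℤ))) _, neg_neg]
  rw [e1, e2, hsC]
  push_cast
  linear_combination ((1 / 2 : ℂ) * (↑(gramCoeff a ((k : ℤ) + 1) ((l : ℤ) + 1)) -
    ↑(gramCoeff a ((k : ℤ) + 1) (-((l : ℤ) + 1))))) * hs2C

/-! ## Odd windows on the odd basis -/

/-- **The band of an odd window on the odd basis**: for `B ≤ P`,
`proj_P φ − proj_B φ = Σ_{k∈[B,P)} (√2 ĉ_{k+1}/√(2a)) • w⁻_{k+1}`. -/
theorem band_eq_sum_chiOdd {φ : ℝ → ℂ} (hφ : ∀ x, φ (-x) = -φ x) (a : ℝ) {B P : ℕ} (hBP : B ≤ P) :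
    proj a P φ - proj a B φ = ∑ k ∈ Finset.Ico B P,
      (((Real.sqrt 2 : ℝ) : ℂ) * ((((1 / Real.sqrt (2 * a) : ℝ) : ℂ)) * Yoshida1992.fourierCoeff a ((k : ℤ) + 1) φ)) •
        chiOdd a (k + 1) := by
  have hodd : ∀ n : ℤ, (((1 / Real.sqrt (2 * a) : ℝ) : ℂ)) * Yoshida1992.fourierCoeff a (-n) φ
      = -((((1 / Real.sqrt (2 * a) : ℝ) : ℂ)) * Yoshida1992.fourierCoeff a n φ) := fun n ↦ by
    rw [fourierCoeff_neg_eq_neg_of_odd hφ, mul_neg]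
  have hexp : ∀ N : ℕ, proj a N φ = ∑ k ∈ Finset.range N,
      (((Real.sqrt 2 : ℝ) : ℂ) * ((((1 / Real.sqrt (2 * a) : ℝ) : ℂ)) * Yoshida1992.fourierCoeff a ((k : ℤ) + 1) φ)) •
        chiOdd a (k + 1) := by
    intro N
    unfold proj
    rw [sum_modes_smul_chi_of_odd N _ hodd]
    rw [show Finset.Icc 1 N = Finset.Ico 1 (N + 1) by ext i; simp only [Finset.mem_Icc, Finset.mem_Ico]; omega,
      Finset.sum_Ico_eq_sum_range]
    refine Finset.sum_congr (by simp) fun k _ ↦ ?_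
    rw [add_comm 1 k]
    push_cast
    rfl
  rw [hexp, hexp, Finset.range_eq_Ico, Finset.range_eq_Ico,
    ← Finset.sum_Ico_consecutive _ (Nat.zero_le B) hBP, add_sub_cancel_left]

/-! ## The row identity and the band × band identity -/

/-- The coefficient `ζ_{k+1}` of an odd real window is `(√2 Im ĉ_{k+1}/√(2a))·i`. -/
theorem zetaOdd_eq {φ : ℝ → ℂ} (hφ : ∀ x, φ (-x) = -φ x) (hφr : ∀ x, conj (φ x) = φ x) (a : ℝ) (k : ℕ) :
    ((Real.sqrt 2 : ℝ) : ℂ) * ((((1 / Real.sqrt (2 * a) : ℝ) : ℂ)) * Yoshida1992.fourierCoeff a ((k : ℤ) + 1) φ)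
      = (((Real.sqrt 2 * (Yoshida1992.fourierCoeff a ((k : ℤ) + 1) φ).im / Real.sqrt (2 * a)) : ℝ) : ℂ) * I := by
  rw [fourierCoeff_eq_im_mul_I hφ hφr]
  simp only [Complex.mul_im, Complex.ofReal_re, Complex.ofReal_im, Complex.I_re, Complex.I_im, mul_zero, mul_one]
  push_cast
  ring

/-- **The row identity** (`a > 0`, `φ` an odd real window function, `B ≤ P`): with the REAL table
`V(k) = 2 Im ĉ_{k+1}(φ)/√(2a)`, `Σ_{k∈[B,P)} M⁻(k,m)·V(k) = Im W_a(proj_P φ − proj_B φ, w⁻_{m+1})/√2`. -/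
theorem sum_Ico_oddKernel_mul_eq (ha : 0 < a) {φ : ℝ → ℂ} (hφ : ∀ x, φ (-x) = -φ x) (hφr : ∀ x, conj (φ x) = φ x)
    {B P : ℕ} (hBP : B ≤ P) (m : ℕ) :
    ∑ k ∈ Finset.Ico B P,
      ((gramCoeff a ((k : ℤ) + 1) ((m : ℤ) + 1) - gramCoeff a ((k : ℤ) + 1) (-((m : ℤ) + 1))) / 2) *
        (2 * (Yoshida1992.fourierCoeff a ((k : ℤ) + 1) φ).im / Real.sqrt (2 * a))
      = (weilWindowSesq a (proj a P φ - proj a B φ) (chiOdd a (m + 1))).im / Real.sqrt 2 := by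
  have hs0 : (0 : ℝ) < Real.sqrt 2 := Real.sqrt_pos.2 (by norm_num)
  have hs2 : Real.sqrt 2 * Real.sqrt 2 = 2 := Real.mul_self_sqrt (by norm_num)
  -- the complex identity `W(band, w⁻_{m+1}) = (Σ … · √2) · i`
  have key : weilWindowSesq a (proj a P φ - proj a B φ) (chiOdd a (m + 1)) =
      ((∑ k ∈ Finset.Ico B P,
        ((gramCoeff a ((k : ℤ) + 1) ((m : ℤ) + 1) - gramCoeff a ((k : ℤ) + 1) (-((m : ℤ) + 1))) / 2) *
          (2 * (Yoshida1992.fourierCoeff a ((k : ℤ) + 1) φ).im / Real.sqrt (2 * a)) * Real.sqrt 2 : ℝ) : ℂ) * I := by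
    rw [band_eq_sum_chiOdd hφ a hBP,
      weilWindowSesq_sum_left ha.le _ (fun k _ ↦ isWindowFunction_chiOdd ha (k + 1)) (isWindowFunction_chiOdd ha _) _ a]
    simp_rw [zetaOdd_eq hφ hφr, weilWindowSesq_chiOdd_chiOdd ha]
    rw [Complex.ofReal_sum, Finset.sum_mul]
    refine Finset.sum_congr rfl fun k _ ↦ ?_
    push_cast
    ring
  rw [key, Complex.mul_im, Complex.ofReal_re, Complex.ofReal_im, Complex.I_re, Complex.I_im]
  simp only [mul_one, mul_zero, add_zero]
  rw [eq_div_iff hs0.ne', Finset.sum_mul]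

/-- **The band × band identity** (`a > 0`, `φ, ψ` odd real window functions, `B ≤ P`):
`Σ_{k,l∈[B,P)} V_φ(k)·M⁻(k,l)·V_ψ(l) = Re W_a(proj_P φ − proj_B φ, proj_P ψ − proj_B ψ)`. -/
theorem sum_Ico_Ico_oddKernel_eq (ha : 0 < a) {φ ψ : ℝ → ℂ} (hφ : ∀ x, φ (-x) = -φ x)
    (hφr : ∀ x, conj (φ x) = φ x) (hψ : ∀ x, ψ (-x) = -ψ x) (hψr : ∀ x, conj (ψ x) = ψ x)
    {B P : ℕ} (hBP : B ≤ P) :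
    ∑ k ∈ Finset.Ico B P, ∑ l ∈ Finset.Ico B P,
      (2 * (Yoshida1992.fourierCoeff a ((k : ℤ) + 1) φ).im / Real.sqrt (2 * a)) *
        ((gramCoeff a ((k : ℤ) + 1) ((l : ℤ) + 1) - gramCoeff a ((k : ℤ) + 1) (-((l : ℤ) + 1))) / 2) *
        (2 * (Yoshida1992.fourierCoeff a ((l : ℤ) + 1) ψ).im / Real.sqrt (2 * a))
      = (weilWindowSesq a (proj a P φ - proj a B φ) (proj a P ψ - proj a B ψ)).re := by
  have hs2 : Real.sqrt 2 * Real.sqrt 2 = 2 := Real.mul_self_sqrt (by norm_num)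
  have hs2C : ((Real.sqrt 2 : ℝ) : ℂ) * ((Real.sqrt 2 : ℝ) : ℂ) = 2 := by
    rw [← Complex.ofReal_mul, hs2]; norm_num
  have key : weilWindowSesq a (proj a P φ - proj a B φ) (proj a P ψ - proj a B ψ) =
      ((∑ k ∈ Finset.Ico B P, ∑ l ∈ Finset.Ico B P,
        (2 * (Yoshida1992.fourierCoeff a ((k : ℤ) + 1) φ).im / Real.sqrt (2 * a)) *
          ((gramCoeff a ((k : ℤ) + 1) ((l : ℤ) + 1) - gramCoeff a ((k : ℤ) + 1) (-((l : ℤ) + 1))) / 2) *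
          (2 * (Yoshida1992.fourierCoeff a ((l : ℤ) + 1) ψ).im / Real.sqrt (2 * a)) : ℝ) : ℂ) := by
    rw [band_eq_sum_chiOdd hφ a hBP, band_eq_sum_chiOdd hψ a hBP,
      weilWindowSesq_sum_left ha.le _ (fun k _ ↦ isWindowFunction_chiOdd ha (k + 1))
        (IsWindowFunction.sum _ _ fun l _ ↦ isWindowFunction_chiOdd ha (l + 1)) _ a]
    simp_rw [weilWindowSesq_sum_right ha.le _ (fun l _ ↦ isWindowFunction_chiOdd ha (l + 1))
      (isWindowFunction_chiOdd ha _) _ a, zetaOdd_eq hφ hφr, zetaOdd_eq hψ hψr, weilWindowSesq_chiOdd_chiOdd ha]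
    rw [Complex.ofReal_sum]
    refine Finset.sum_congr rfl fun k _ ↦ ?_
    rw [Finset.mul_sum, Complex.ofReal_sum]
    refine Finset.sum_congr rfl fun l _ ↦ ?_
    rw [map_mul, Complex.conj_ofReal, Complex.conj_I]
    push_cast
    linear_combination (((Yoshida1992.fourierCoeff a ((k : ℤ) + 1) φ).im : ℂ) *
        ((Yoshida1992.fourierCoeff a ((l : ℤ) + 1) ψ).im : ℂ) / ((Real.sqrt (2 * a) : ℂ) * (Real.sqrt (2 * a) : ℂ)) *
        (↑(gramCoeff a ((k : ℤ) + 1) (-((l : ℤ) + 1))) - ((gramCoeff a ((k : ℤ) + 1) ((l : ℤ) + 1) : ℝ) : ℂ)) *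
        I ^ 2) * hs2C
      + (2 * (((Yoshida1992.fourierCoeff a ((k : ℤ) + 1) φ).im : ℂ) *
        ((Yoshida1992.fourierCoeff a ((l : ℤ) + 1) ψ).im : ℂ) / ((Real.sqrt (2 * a) : ℂ) * (Real.sqrt (2 * a) : ℂ))) *
        (↑(gramCoeff a ((k : ℤ) + 1) (-((l : ℤ) + 1))) - ((gramCoeff a ((k : ℤ) + 1) ((l : ℤ) + 1) : ℝ) : ℂ))) *
        Complex.I_mul_I
  rw [key, Complex.ofReal_re]

/-! ## Limits: the hypotheses `hc`, `hG` of the C∞ soundness theorem for odd profiles -/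

section Limits

/-- The odd basis vector `w⁻_{m+1}` as a trigonometric window on `{m+1, −(m+1)}`. -/
theorem chiOdd_eq_sum_smul_chi (a : ℝ) (m : ℕ) :
    chiOdd a (m + 1) = ∑ p ∈ ({((m : ℤ) + 1), -((m : ℤ) + 1)} : Finset ℤ),
      (if 0 < p then (((1 / Real.sqrt 2 : ℝ)) : ℂ) else -(((1 / Real.sqrt 2 : ℝ)) : ℂ)) • chi a p := by
  unfold chiOdd
  have hne : ((m : ℤ) + 1) ≠ -((m : ℤ) + 1) := by omega
  rw [Finset.sum_pair hne, if_pos (by omega), if_neg (by omega), smul_sub, neg_smul, sub_eq_add_neg]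
  push_cast
  rfl

variable {f g : ℝ → ℂ}

/-- **`hc` for an odd profile**: for `f ∈ C³` odd, real, with `f(a) = 0` and `f′(−a) = f′(a)` (`a > 0`), the kernel rows
of the table `V(k) = 2 Im ĉ_{k+1}(1f)/√(2a)` against the odd kernel converge:
`Σ_{k∈[B,P)} M⁻(k,m)V(k) → Im W_a(1f − proj_B(1f), w⁻_{m+1})/√2`. -/
theorem tendsto_sum_Ico_oddKernel_mul (ha : 0 < a) (hf : ContDiff ℝ 3 f) (hfo : ∀ x, f (-x) = -f x)
    (hfr : ∀ x, conj (f x) = f x) (hfa : f a = 0) (hf1 : deriv f (-a) = deriv f a) (B m : ℕ) :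
    Tendsto (fun P ↦ ∑ k ∈ Finset.Ico B P,
      ((gramCoeff a ((k : ℤ) + 1) ((m : ℤ) + 1) - gramCoeff a ((k : ℤ) + 1) (-((m : ℤ) + 1))) / 2) *
        (2 * (Yoshida1992.fourierCoeff a ((k : ℤ) + 1) ((Icc (-a) a).indicator f)).im / Real.sqrt (2 * a)))
      atTop
      (𝓝 ((weilWindowSesq a ((Icc (-a) a).indicator f - proj a B ((Icc (-a) a).indicator f)) (chiOdd a (m + 1))).im /
        Real.sqrt 2)) := by
  set φ := (Icc (-a) a).indicator f with hφdef
  have hφ : ∀ x, φ (-x) = -φ x := indicator_odd hfo a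
  have hφr : ∀ x, conj (φ x) = φ x := indicator_real hfr a
  have hfe₀ : f (-a) = f a := by rw [hfo, hfa, neg_zero]
  -- the band limit in the left slot, via conjugate symmetry (imaginary part changes sign twice: we use `im ∘ conj`)
  have hlim : Tendsto (fun P ↦ (weilWindowSesq a (proj a P φ - proj a B φ) (chiOdd a (m + 1))).im) atTop
      (𝓝 ((weilWindowSesq a (φ - proj a B φ) (chiOdd a (m + 1))).im)) := by
    have h := tendsto_weilWindowSesq_trig_band_indicator ha ({((m : ℤ) + 1), -((m : ℤ) + 1)} : Finset ℤ)
      (fun p ↦ if 0 < p then (((1 / Real.sqrt 2 : ℝ)) : ℂ) else -(((1 / Real.sqrt 2 : ℝ)) : ℂ)) hf hfe₀ hf1 B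
    rw [← chiOdd_eq_sum_smul_chi] at h
    have h' := ((Complex.continuous_conj.tendsto _).comp h)
    have h'' := (Complex.continuous_im.tendsto _).comp h'
    refine (h''.congr fun P ↦ ?_).trans ?_
    · simp only [Function.comp]
      rw [← weilWindowSesq_conj_symm]
    · rw [← weilWindowSesq_conj_symm]
  refine ((hlim.div_const (Real.sqrt 2)).congr' ?_)
  filter_upwards [eventually_ge_atTop B] with P hP
  rw [sum_Ico_oddKernel_mul_eq ha hφ hφr hP m]

/-- **`hG` for two odd profiles**: the band × band entries converge:
`Σ_{k,l∈[B,P)} V_f(k)M⁻(k,l)V_g(l) → Re W_a(1f − proj_B 1f, 1g − proj_B 1g)`. -/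
theorem tendsto_sum_Ico_Ico_oddKernel (ha : 0 < a) (hf : ContDiff ℝ 3 f) (hfo : ∀ x, f (-x) = -f x)
    (hfr : ∀ x, conj (f x) = f x) (hfa : f a = 0) (hf1 : deriv f (-a) = deriv f a) (hg : ContDiff ℝ 3 g)
    (hgo : ∀ x, g (-x) = -g x) (hgr : ∀ x, conj (g x) = g x) (hga : g a = 0) (hg1 : deriv g (-a) = deriv g a)
    (B : ℕ) :
    Tendsto (fun P ↦ ∑ k ∈ Finset.Ico B P, ∑ l ∈ Finset.Ico B P,
      (2 * (Yoshida1992.fourierCoeff a ((k : ℤ) + 1) ((Icc (-a) a).indicator f)).im / Real.sqrt (2 * a)) *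
        ((gramCoeff a ((k : ℤ) + 1) ((l : ℤ) + 1) - gramCoeff a ((k : ℤ) + 1) (-((l : ℤ) + 1))) / 2) *
        (2 * (Yoshida1992.fourierCoeff a ((l : ℤ) + 1) ((Icc (-a) a).indicator g)).im / Real.sqrt (2 * a)))
      atTop
      (𝓝 ((weilWindowSesq a ((Icc (-a) a).indicator f - proj a B ((Icc (-a) a).indicator f))
        ((Icc (-a) a).indicator g - proj a B ((Icc (-a) a).indicator g))).re)) := by
  set φ := (Icc (-a) a).indicator f with hφdef
  set ψ := (Icc (-a) a).indicator g with hψdef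
  have hφ : ∀ x, φ (-x) = -φ x := indicator_odd hfo a
  have hφr : ∀ x, conj (φ x) = φ x := indicator_real hfr a
  have hψ : ∀ x, ψ (-x) = -ψ x := indicator_odd hgo a
  have hψr : ∀ x, conj (ψ x) = ψ x := indicator_real hgr a
  have hfe₀ : f (-a) = f a := by rw [hfo, hfa, neg_zero]
  have hge₀ : g (-a) = g a := by rw [hgo, hga, neg_zero]
  have h := tendsto_weilWindowSesq_band_band_indicator ha hf hfe₀ hf1 hg hge₀ hg1 B
  have h' := (Complex.continuous_re.tendsto _).comp h
  refine h'.congr' ?_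
  filter_upwards [eventually_ge_atTop B] with P hP
  simp only [Function.comp]
  rw [sum_Ico_Ico_oddKernel_eq ha hφ hφr hψ hψr hP]

end Limits

end Summit.RiemannHypothesis.RiemannHypothesis.Theorems.WeilFormatC

end
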